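import Summits.HubbardSuperconductivity.HubbardSuperconductivity.Theorems.AnisotropyChordStiffnessNearFarPairs
import Summits.HubbardSuperconductivity.HubbardSuperconductivity.Theorems.AnisotropyChordStiffnessNearField
import Summits.HubbardSuperconductivity.HubbardSuperconductivity.Theorems.AnisotropyChordStiffnessLocalOps
import Literature.MathematicalPhysics.QuantumLattice.QuasiLocalPiecesProofs
import Literature.MathematicalPhysics.QuantumLattice.StabilityReductionProofs
import Mathlib.Analysis.SpecialFunctions.Trigonometric.Bounds
import Mathlib.Analysis.SpecialFunctions.Trigonometric.DerivHyp
import Mathlib.Analysis.SpecificLimits.Normed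

/-!
# Route `AnisotropyChord` / H0 rotor rung: the torus-geometry stubs G2–G5 of the near/far split DISCHARGED
# (theory seat memo ROTOR-THEORY-8 §122(d)/§123; Sketch8 Part S)

* G2 `phaseLipschitz_holds : PhaseLipschitz` — `|φ_k(y − x) − 1| ≤ 2|k|_T d_∞(x,y)`;
* G3 `ballCount_holds : BallCount` — `#{y : d_∞(x,y) ≤ R} ≤ (2R+1)²`;
* G4 `farExpSum_holds : FarExpSum` — `Σ_{d_∞(x,y) > R} e^{−a d} ≤ 8e^{−aR}((R+1)(1+1/a) + 1/a²)` (shells `#{d_∞ = r} ≤ 8r`,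
  geometric tail, `1/(1−e^{−a}) ≤ 1 + 1/a` (inline), `exp_neg_div_sq_le : e^{−a}/(1−e^{−a})² ≤ 1/a²`);
* G5 `bondCurrentBound_holds : BondCurrentBound` — `‖j_{xy} w‖ ≤ ‖w‖` (from `norm_toLp_bondCurrent_mulVec_le`).
-/

set_option linter.dupNamespace false

noncomputable section

open Matrix Complex Finset Filter Topology
open scoped ComplexConjugate
open Literature.MathematicalPhysics.QuantumLattice hiding torusPhase torusNorm
open Literature.Probability.LatticeModels
open Summit.HubbardSuperconductivity.HubbardSuperconductivity.Theorems.AnisotropyChord.InsertionEntropy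

namespace Summit.HubbardSuperconductivity.HubbardSuperconductivity.Theorems.AnisotropyChord.Stiffness

variable {L : ℕ} [NeZero L]

/-! ## The periodic `ℓ^∞` distance in terms of centred representatives -/

/-- The periodic size of a residue, `|c|_L = |valMinAbs c| = min (c, L − c)`. -/
theorem natAbs_valMinAbs_eq_min (c : ZMod L) : (c.valMinAbs.natAbs : ℕ) = min c.val (L - c.val) :=
  ZMod.valMinAbs_natAbs_eq_min c

/-- `torusDist x y = maxᵢ |valMinAbs ((x − y) i)|`. -/
theorem torusDist_eq_sup (x y : TorusSite 2 L) :
    torusDist (Ls := fun _ : Fin 2 => L) x y = Finset.univ.sup fun i => ((x - y) i).valMinAbs.natAbs := by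
  unfold torusDist Literature.MathematicalPhysics.QuantumLattice.torusNorm
  congr 1
  funext i
  rw [natAbs_valMinAbs_eq_min]

/-- Each centred coordinate of `y − x` is bounded by the torus distance. -/
theorem natAbs_valMinAbs_sub_le_torusDist (x y : TorusSite 2 L) (i : Fin 2) :
    ((y - x) i).valMinAbs.natAbs ≤ torusDist (Ls := fun _ : Fin 2 => L) x y := by
  rw [torusDist_eq_sup]
  have h : ((y - x) i).valMinAbs.natAbs = ((x - y) i).valMinAbs.natAbs := by
    rw [show (y - x) i = -((x - y) i) by simp, ZMod.natAbs_valMinAbs_neg]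
  rw [h]
  exact Finset.le_sup (f := fun i : Fin 2 => ((x - y) i).valMinAbs.natAbs) (Finset.mem_univ i)

/-! ## G2 — phase Lipschitz bound -/

/-- **G2 PROVED**: `|φ_k(y − x) − 1| ≤ 2|k|_T·d_∞(x,y)`. -/
theorem phaseLipschitz_holds : PhaseLipschitz := by
  intro L _ k x y
  set θ : ℝ := 2 * Real.pi / (L : ℝ) *
    ∑ i, (((k i).valMinAbs : ℤ) : ℝ) * ((((y - x) i).valMinAbs : ℤ) : ℝ) with hθ
  have hph : torusPhase L k (y - x) = cexp ((θ : ℂ) * I) := torusPhase_eq_cexp_valMinAbs k (y - x)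
  have h1 : ‖torusPhase L k (y - x) - 1‖ ≤ |θ| := by
    rw [hph, mul_comm]
    have := Real.norm_exp_I_mul_ofReal_sub_one_le (x := θ)
    simpa [Real.norm_eq_abs] using this
  have hsq := sq_signedPhase_le k (y - x) (torusDist (Ls := fun _ : Fin 2 => L) x y)
    (natAbs_valMinAbs_sub_le_torusDist x y)
  have hk0 : 0 ≤ torusNorm L k := torusNorm_nonneg k
  have hd0 : 0 ≤ tdist L x y := tdist_nonneg L x y
  have h2 : |θ| ≤ 2 * torusNorm L k * tdist L x y := by
    have hsq' : θ ^ 2 ≤ (2 * torusNorm L k * tdist L x y) ^ 2 := by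
      unfold tdist
      nlinarith [hsq, sq_nonneg (torusNorm L k * (torusDist (Ls := fun _ : Fin 2 => L) x y : ℝ))]
    exact abs_le.2 (abs_le_of_sq_le_sq' hsq' (by positivity))
  exact h1.trans h2

/-! ## G3 — ball count -/

/-- The real ball `{y : tdist x y ≤ R}` is the integer torus ball of radius `⌊R⌋₊`. -/
theorem filter_tdist_le_eq_torusBall (x : TorusSite 2 L) {R : ℝ} (hR : 0 ≤ R) :
    (Finset.univ.filter fun y : TorusSite 2 L => tdist L x y ≤ R)
      = torusBall (Ls := fun _ : Fin 2 => L) x ⌊R⌋₊ := by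
  ext y
  simp only [Finset.mem_filter, Finset.mem_univ, true_and, mem_torusBall_iff, tdist]
  exact (Nat.le_floor_iff hR).symm

/-- **G3 PROVED**: `#{y : d_∞(x,y) ≤ R} ≤ (2R+1)²`. -/
theorem ballCount_holds : BallCount := by
  intro L _ x R hR
  rw [filter_tdist_le_eq_torusBall x hR]
  have h := card_torusBall_le (d := 2) (L := L) x ⌊R⌋₊
  have hfl : (⌊R⌋₊ : ℝ) ≤ R := Nat.floor_le hR
  calc ((torusBall (Ls := fun _ : Fin 2 => L) x ⌊R⌋₊).card : ℝ)
      ≤ ((2 * ⌊R⌋₊ + 1) ^ 2 : ℕ) := by exact_mod_cast h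
    _ = (2 * (⌊R⌋₊ : ℝ) + 1) ^ 2 := by push_cast; ring
    _ ≤ (2 * R + 1) ^ 2 := pow_le_pow_left₀ (by positivity) (by linarith) 2

/-! ## G4 — shells and the far exponential sum -/

/-- Residues of periodic size exactly `r` are `±r`: at most two of them. -/
theorem card_filter_natAbs_valMinAbs_eq_le (r : ℕ) :
    (Finset.univ.filter fun c : ZMod L => c.valMinAbs.natAbs = r).card ≤ 2 := by
  have hsub : (Finset.univ.filter fun c : ZMod L => c.valMinAbs.natAbs = r)
      ⊆ {((r : ℤ) : ZMod L), ((-(r : ℤ) : ℤ) : ZMod L)} := by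
    intro c hc
    simp only [Finset.mem_filter, Finset.mem_univ, true_and] at hc
    simp only [Finset.mem_insert, Finset.mem_singleton]
    rcases Int.natAbs_eq_iff.1 hc with h | h
    · left; rw [← ZMod.coe_valMinAbs c, h]
    · right; rw [← ZMod.coe_valMinAbs c, h]
  exact (Finset.card_le_card hsub).trans (Finset.card_le_two)

/-- Residues of periodic size `≤ r`: at most `2r + 1` of them. -/
theorem card_filter_natAbs_valMinAbs_le_le (r : ℕ) :
    (Finset.univ.filter fun c : ZMod L => c.valMinAbs.natAbs ≤ r).card ≤ 2 * r + 1 := by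
  have h := card_filter_cyclicAbs_le_le (L := L) r
  have he : (Finset.univ.filter fun c : ZMod L => c.valMinAbs.natAbs ≤ r)
      = Finset.univ.filter fun z : ZMod L => min z.val (L - z.val) ≤ r := by
    ext c
    simp only [Finset.mem_filter, Finset.mem_univ, true_and, natAbs_valMinAbs_eq_min]
  rw [he]
  exact h

/-- A mixed slab `{z : |z i| = r, |z i'| ≤ s}` (`i ≠ i'`) has at most `2(2s+1)` points. -/
theorem card_filter_slab_le (r s : ℕ) (i i' : Fin 2) (hii' : i ≠ i') :
    (Finset.univ.filter fun z : TorusSite 2 L =>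
        (z i).valMinAbs.natAbs = r ∧ (z i').valMinAbs.natAbs ≤ s).card ≤ 2 * (2 * s + 1) := by
  set A := Finset.univ.filter fun c : ZMod L => c.valMinAbs.natAbs = r
  set B := Finset.univ.filter fun c : ZMod L => c.valMinAbs.natAbs ≤ s
  have hmap : ∀ z ∈ (Finset.univ.filter fun z : TorusSite 2 L =>
        (z i).valMinAbs.natAbs = r ∧ (z i').valMinAbs.natAbs ≤ s), (z i, z i') ∈ A ×ˢ B := by
    intro z hz
    simp only [Finset.mem_filter, Finset.mem_univ, true_and] at hz
    simp only [A, B, Finset.mem_product, Finset.mem_filter, Finset.mem_univ, true_and]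
    exact hz
  have hinj : Set.InjOn (fun z : TorusSite 2 L => (z i, z i'))
      ↑(Finset.univ.filter fun z : TorusSite 2 L =>
        (z i).valMinAbs.natAbs = r ∧ (z i').valMinAbs.natAbs ≤ s) := by
    intro z _ w _ hzw
    simp only [Prod.mk.injEq] at hzw
    funext l
    have fin2 : ∀ t : Fin 2, t = i ∨ t = i' := by
      intro t
      fin_cases i <;> fin_cases i' <;> first | exact absurd rfl hii' | (fin_cases t <;> simp)
    rcases fin2 l with hl | hl <;> subst hl
    · exact hzw.1
    · exact hzw.2
  calc (Finset.univ.filter fun z : TorusSite 2 L =>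
        (z i).valMinAbs.natAbs = r ∧ (z i').valMinAbs.natAbs ≤ s).card
      ≤ (A ×ˢ B).card := Finset.card_le_card_of_injOn _ hmap hinj
    _ = A.card * B.card := Finset.card_product A B
    _ ≤ 2 * (2 * s + 1) :=
        Nat.mul_le_mul (card_filter_natAbs_valMinAbs_eq_le r) (card_filter_natAbs_valMinAbs_le_le s)

/-- **Shell count**: `#{z : ‖z‖_∞ = r} ≤ 8r` for `r ≥ 1` on the `L × L` torus. -/
theorem card_filter_torusNorm_eq_le {r : ℕ} (hr : 1 ≤ r) :
    (Finset.univ.filter fun z : TorusSite 2 L =>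
      Literature.MathematicalPhysics.QuantumLattice.torusNorm (Ls := fun _ : Fin 2 => L) z = r).card ≤ 8 * r := by
  have hsub : (Finset.univ.filter fun z : TorusSite 2 L =>
      Literature.MathematicalPhysics.QuantumLattice.torusNorm (Ls := fun _ : Fin 2 => L) z = r)
      ⊆ (Finset.univ.filter fun z : TorusSite 2 L =>
            (z 0).valMinAbs.natAbs = r ∧ (z 1).valMinAbs.natAbs ≤ r)
        ∪ (Finset.univ.filter fun z : TorusSite 2 L =>
            (z 1).valMinAbs.natAbs = r ∧ (z 0).valMinAbs.natAbs ≤ r - 1) := by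
    intro z hz
    simp only [Finset.mem_filter, Finset.mem_univ, true_and] at hz
    have hz' : Finset.univ.sup (fun i : Fin 2 => (z i).valMinAbs.natAbs) = r := by
      rw [← hz]
      unfold Literature.MathematicalPhysics.QuantumLattice.torusNorm
      congr 1; funext i; rw [natAbs_valMinAbs_eq_min]
    have hle : ∀ i : Fin 2, (z i).valMinAbs.natAbs ≤ r := fun i => by
      rw [← hz']; exact Finset.le_sup (f := fun i : Fin 2 => (z i).valMinAbs.natAbs) (Finset.mem_univ i)
    simp only [Finset.mem_union, Finset.mem_filter, Finset.mem_univ, true_and]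
    by_cases h0 : (z 0).valMinAbs.natAbs = r
    · exact Or.inl ⟨h0, hle 1⟩
    · right
      have h0' : (z 0).valMinAbs.natAbs ≤ r - 1 := by have := hle 0; omega
      refine ⟨?_, h0'⟩
      by_contra h1
      have h1' : (z 1).valMinAbs.natAbs ≤ r - 1 := by have := hle 1; omega
      have hsup : Finset.univ.sup (fun i : Fin 2 => (z i).valMinAbs.natAbs) ≤ r - 1 :=
        Finset.sup_le fun i _ => by fin_cases i <;> assumption
      omega
  calc _ ≤ _ := Finset.card_le_card hsub
    _ ≤ _ := Finset.card_union_le _ _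
    _ ≤ 2 * (2 * r + 1) + 2 * (2 * (r - 1) + 1) :=
        Nat.add_le_add (card_filter_slab_le r r 0 1 (by decide))
          (card_filter_slab_le r (r - 1) 1 0 (by decide))
    _ = 8 * r := by omega

/-- The distance shell around `x`: `#{y : d_∞(x,y) = r} ≤ 8r` for `r ≥ 1`. -/
theorem card_filter_torusDist_eq_le (x : TorusSite 2 L) {r : ℕ} (hr : 1 ≤ r) :
    (Finset.univ.filter fun y : TorusSite 2 L =>
      torusDist (Ls := fun _ : Fin 2 => L) x y = r).card ≤ 8 * r := by
  have hmap : ∀ y ∈ (Finset.univ.filter fun y : TorusSite 2 L =>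
        torusDist (Ls := fun _ : Fin 2 => L) x y = r),
      (fun y => x - y) y ∈ (Finset.univ.filter fun z : TorusSite 2 L =>
        Literature.MathematicalPhysics.QuantumLattice.torusNorm (Ls := fun _ : Fin 2 => L) z = r) := by
    intro y hy
    simp only [Finset.mem_filter, Finset.mem_univ, true_and] at hy ⊢
    exact hy
  have hinj : Set.InjOn (fun y : TorusSite 2 L => x - y)
      ↑(Finset.univ.filter fun y : TorusSite 2 L => torusDist (Ls := fun _ : Fin 2 => L) x y = r) :=
    fun y _ w _ h => sub_right_injective h
  exact (Finset.card_le_card_of_injOn _ hmap hinj).trans (card_filter_torusNorm_eq_le hr)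

/-- Geometric tail with a linear weight: `Σ_{r₀ ≤ r < N} r q^r ≤ q^{r₀}(r₀/(1−q) + q/(1−q)²)` for `0 ≤ q < 1`. -/
theorem sum_mul_geometric_tail_le {q : ℝ} (hq0 : 0 ≤ q) (hq1 : q < 1) (r₀ N : ℕ) :
    ∑ r ∈ (Finset.range N).filter (fun r => r₀ ≤ r), (r : ℝ) * q ^ r
      ≤ q ^ r₀ * ((r₀ : ℝ) / (1 - q) + q / (1 - q) ^ 2) := by
  have hnn : ∀ r : ℕ, 0 ≤ (r : ℝ) * q ^ r := fun r => by positivity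
  -- shift `r = r₀ + m`
  have hsub : (Finset.range N).filter (fun r => r₀ ≤ r) ⊆ (Finset.range N).map (addLeftEmbedding r₀) := by
    intro r hr
    simp only [Finset.mem_filter, Finset.mem_range] at hr
    rw [Finset.mem_map]
    exact ⟨r - r₀, by simp only [Finset.mem_range]; omega, by simp only [addLeftEmbedding_apply]; omega⟩
  have h1 : ∑ r ∈ (Finset.range N).filter (fun r => r₀ ≤ r), (r : ℝ) * q ^ r
      ≤ ∑ r ∈ (Finset.range N).map (addLeftEmbedding r₀), (r : ℝ) * q ^ r :=
    Finset.sum_le_sum_of_subset_of_nonneg hsub fun r _ _ => hnn r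
  rw [Finset.sum_map] at h1
  simp only [addLeftEmbedding_apply, Nat.cast_add, pow_add] at h1
  -- `Σ_m (r₀ + m) q^{r₀} q^m = q^{r₀} (r₀ Σ q^m + Σ m q^m)`
  have h2 : ∑ m ∈ Finset.range N, ((r₀ : ℝ) + (m : ℝ)) * (q ^ r₀ * q ^ m)
      = q ^ r₀ * ((r₀ : ℝ) * ∑ m ∈ Finset.range N, q ^ m + ∑ m ∈ Finset.range N, (m : ℝ) * q ^ m) := by
    rw [Finset.mul_sum, mul_add, Finset.mul_sum, Finset.mul_sum, ← Finset.sum_add_distrib]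
    refine Finset.sum_congr rfl fun m _ => ?_
    ring
  rw [h2] at h1
  have hnorm : ‖q‖ < 1 := by rw [Real.norm_eq_abs, abs_of_nonneg hq0]; exact hq1
  have hg : ∑ m ∈ Finset.range N, q ^ m ≤ 1 / (1 - q) := by
    have := sum_le_hasSum (Finset.range N) (fun m _ => pow_nonneg hq0 m) (hasSum_geometric_of_lt_one hq0 hq1)
    simpa [one_div] using this
  have hg' : ∑ m ∈ Finset.range N, (m : ℝ) * q ^ m ≤ q / (1 - q) ^ 2 :=
    sum_le_hasSum (Finset.range N) (fun m _ => hnn m) (hasSum_coe_mul_geometric_of_norm_lt_one hnorm)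
  have hq1' : 0 < 1 - q := by linarith
  calc _ ≤ _ := h1
    _ ≤ q ^ r₀ * ((r₀ : ℝ) / (1 - q) + q / (1 - q) ^ 2) := by
        apply mul_le_mul_of_nonneg_left _ (pow_nonneg hq0 _)
        have : (r₀ : ℝ) * ∑ m ∈ Finset.range N, q ^ m ≤ (r₀ : ℝ) / (1 - q) := by
          rw [div_eq_mul_one_div]
          exact mul_le_mul_of_nonneg_left hg (Nat.cast_nonneg _)
        linarith

/-- `e^{−a}/(1 − e^{−a})² ≤ 1/a²` for `a > 0` (from `a ≤ 2 sinh (a/2)`). -/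
theorem exp_neg_div_sq_le {a : ℝ} (ha : 0 < a) :
    Real.exp (-a) / (1 - Real.exp (-a)) ^ 2 ≤ 1 / a ^ 2 := by
  have hq1 : Real.exp (-a) < 1 := Real.exp_lt_one_iff.2 (by linarith)
  have hpos : 0 < 1 - Real.exp (-a) := by linarith
  have hsinh : a / 2 ≤ Real.sinh (a / 2) := Real.self_le_sinh_iff.2 (by linarith)
  rw [Real.sinh_eq] at hsinh
  -- `a ≤ e^{a/2} − e^{−a/2}`, square and multiply by `e^{−a}`:
  have ha2 : a ≤ Real.exp (a / 2) - Real.exp (-(a / 2)) := by linarith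
  have hprod : Real.exp (-a) * (Real.exp (a / 2) - Real.exp (-(a / 2))) ^ 2 = (1 - Real.exp (-a)) ^ 2 := by
    have e1 : Real.exp (-a) = Real.exp (-(a / 2)) * Real.exp (-(a / 2)) := by
      rw [← Real.exp_add]; ring_nf
    have e2 : Real.exp (-(a / 2)) * Real.exp (a / 2) = 1 := by rw [← Real.exp_add]; simp
    rw [e1]
    nlinarith [e2]
  have hsq : a ^ 2 ≤ (Real.exp (a / 2) - Real.exp (-(a / 2))) ^ 2 :=
    pow_le_pow_left₀ ha.le ha2 2
  rw [div_le_div_iff₀ (by positivity) (by positivity), one_mul]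
  calc Real.exp (-a) * a ^ 2 ≤ Real.exp (-a) * (Real.exp (a / 2) - Real.exp (-(a / 2))) ^ 2 :=
        mul_le_mul_of_nonneg_left hsq (Real.exp_pos _).le
    _ = (1 - Real.exp (-a)) ^ 2 := hprod

/-- **G4 PROVED**: `Σ_{y : d_∞(x,y) > R} e^{−a d_∞(x,y)} ≤ 8e^{−aR}((R+1)(1 + 1/a) + 1/a²)`. -/
theorem farExpSum_holds : FarExpSum := by
  intro a ha L _ x R hR
  set q : ℝ := Real.exp (-a) with hq
  have hq0 : 0 ≤ q := (Real.exp_pos _).le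
  have hq1 : q < 1 := Real.exp_lt_one_iff.2 (by linarith)
  set n : TorusSite 2 L → ℕ := fun y => torusDist (Ls := fun _ : Fin 2 => L) x y with hn
  set r₀ : ℕ := ⌊R⌋₊ + 1 with hr₀
  set far := Finset.univ.filter (fun y : TorusSite 2 L => ¬ tdist L x y ≤ R) with hfar
  -- rewrite the summand as `q^{n y}`
  have hterm : ∀ y, Real.exp (-(a * tdist L x y)) = q ^ (n y) := by
    intro y
    rw [hq, ← Real.exp_nat_mul]
    congr 1
    simp only [tdist, hn]
    ring
  have hfar_iff : ∀ y, y ∈ far ↔ r₀ ≤ n y := by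
    intro y
    simp only [hfar, Finset.mem_filter, Finset.mem_univ, true_and, not_le, tdist, hn, hr₀]
    rw [← Nat.floor_lt hR]
    exact Nat.lt_iff_add_one_le
  -- fiberwise over the value of `n`
  set T := (Finset.range (L + 1)).filter (fun r => r₀ ≤ r) with hT
  have hmaps : ∀ y ∈ far, n y ∈ T := by
    intro y hy
    simp only [hT, Finset.mem_filter, Finset.mem_range]
    exact ⟨Nat.lt_succ_of_le (torusDist_le x y), (hfar_iff y).1 hy⟩
  have hshell : ∀ r ∈ T, ∑ y ∈ far.filter (fun y => n y = r), q ^ (n y) ≤ 8 * ((r : ℝ) * q ^ r) := by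
    intro r hr
    simp only [hT, Finset.mem_filter, Finset.mem_range] at hr
    have hr1 : 1 ≤ r := by omega
    have hc : (far.filter fun y => n y = r).card ≤ 8 * r :=
      (Finset.card_le_card (Finset.filter_subset_filter _ (Finset.subset_univ far))).trans
        (card_filter_torusDist_eq_le x hr1)
    have heq : ∑ y ∈ far.filter (fun y => n y = r), q ^ (n y)
        = ((far.filter fun y => n y = r).card : ℝ) * q ^ r := by
      rw [Finset.sum_congr rfl (g := fun _ => q ^ r), Finset.sum_const, nsmul_eq_mul]
      intro y hy
      simp only [Finset.mem_filter] at hy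
      rw [hy.2]
    rw [heq]
    calc ((far.filter fun y => n y = r).card : ℝ) * q ^ r ≤ ((8 * r : ℕ) : ℝ) * q ^ r :=
          mul_le_mul_of_nonneg_right (by exact_mod_cast hc) (pow_nonneg hq0 r)
      _ = 8 * ((r : ℝ) * q ^ r) := by push_cast; ring
  -- the constants
  have hr₀R : R < (r₀ : ℝ) := by rw [hr₀]; push_cast; exact Nat.lt_floor_add_one R
  have hr₀R' : (r₀ : ℝ) ≤ R + 1 := by rw [hr₀]; push_cast; linarith [Nat.floor_le hR]
  have hqr₀ : q ^ r₀ ≤ Real.exp (-(a * R)) := by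
    rw [hq, ← Real.exp_nat_mul, Real.exp_le_exp]
    nlinarith
  have hq1' : 0 < 1 - q := by linarith
  have hA : (r₀ : ℝ) / (1 - q) ≤ (R + 1) * (1 + 1 / a) := by
    rw [div_eq_mul_one_div]
    -- `1/(1 − e^{−a}) ≤ 1 + 1/a` (from `1 + a ≤ e^{a}`; cf. `inv_one_sub_exp_neg_le` in the L-function corner of Literature)
    have hinv : 1 / (1 - Real.exp (-a)) ≤ 1 + 1 / a := by
      have hq1a : Real.exp (-a) < 1 := Real.exp_lt_one_iff.2 (by linarith)
      have hposa : 0 < 1 - Real.exp (-a) := by linarith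
      rw [div_le_iff₀ hposa]
      have h1 : (1 + a) * Real.exp (-a) ≤ 1 := by
        have := Real.add_one_le_exp a
        have hea : Real.exp (-a) * Real.exp a = 1 := by rw [← Real.exp_add]; simp
        nlinarith [Real.exp_pos (-a), Real.exp_pos a]
      field_simp
      nlinarith [h1, Real.exp_pos (-a)]
    exact mul_le_mul hr₀R' hinv (by positivity) (by positivity)
  have hB : q / (1 - q) ^ 2 ≤ 1 / a ^ 2 := exp_neg_div_sq_le ha
  calc ∑ y ∈ far, Real.exp (-(a * tdist L x y)) = ∑ y ∈ far, q ^ (n y) :=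
        Finset.sum_congr rfl fun y _ => hterm y
    _ = ∑ r ∈ T, ∑ y ∈ far.filter (fun y => n y = r), q ^ (n y) :=
        (Finset.sum_fiberwise_of_maps_to hmaps _).symm
    _ ≤ ∑ r ∈ T, 8 * ((r : ℝ) * q ^ r) := Finset.sum_le_sum hshell
    _ = 8 * ∑ r ∈ T, (r : ℝ) * q ^ r := by rw [← Finset.mul_sum]
    _ ≤ 8 * (q ^ r₀ * ((r₀ : ℝ) / (1 - q) + q / (1 - q) ^ 2)) := by
        have := sum_mul_geometric_tail_le hq0 hq1 r₀ (L + 1)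
        linarith
    _ ≤ 8 * (Real.exp (-(a * R)) * ((R + 1) * (1 + 1 / a) + 1 / a ^ 2)) := by
        have h := mul_le_mul hqr₀ (add_le_add hA hB) (by positivity) (Real.exp_pos _).le
        linarith
    _ = 8 * Real.exp (-(a * R)) * ((R + 1) * (1 + 1 / a) + 1 / a ^ 2) := by ring

/-! ## G5 — the bond current is a contraction -/

/-- **G5 PROVED**: `‖j_{xy} w‖ ≤ ‖w‖` (indeed `≤ ‖w‖/2`, `norm_toLp_bondCurrent_mulVec_le`). -/
theorem bondCurrentBound_holds : BondCurrentBound := by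
  intro L _ x y w
  have h := norm_toLp_bondCurrent_mulVec_le x y w
  linarith [norm_nonneg (WithLp.toLp 2 w)]

end Summit.HubbardSuperconductivity.HubbardSuperconductivity.Theorems.AnisotropyChord.Stiffness
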